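import Literature.NumberTheory.LFunctions.BaezDuarteLowerBound
import HarnessLib

/-!
# RH-EQUIVALENT·SPLITTING CENSUS (nb, neg) · V34 «MASS», part 1: the coefficient-mass law of Nyman–Beurling approximation (unconditional real analysis + one critical-line zero); nothing here bears on the truth of RH

LABEL (line 1): RH-EQUIVALENT·SPLITTING (cell `rh-split`, seat (nb, neg), generation 9, census
candidate V34, part 1 of 2). KERNEL FACTS PROVED HERE ARE UNCONDITIONAL REAL ANALYSIS about the
Nyman–Beurling error function `f = χ − Σ_j c_j ρ_{a_j}` (`BaezDuarteU.nbFun a c`, real dilations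
`a_j ≥ 1`, real coefficients `c_j`) at ONE critical-line zero of `ζ` (Hardy 1914 is a theorem of the
tree, `BaezDuarteU.exists_zeta_zero_half`; in this part the zero is a hypothesis `hγ`). NOTHING HERE
BEARS ON THE TRUTH OF RH.

## The census question (brief (iii), lens neg)

Is there a splitting `A ∧ B ⟹ RH` of the Nyman–Beurling / Báez-Duarte criterion with `A` or `B`
cheaply refutable? Candidate V34 puts the resource on the COEFFICIENT side (V1–V33 put it on the
distance sequence `d_N`): «MASS(B)» := for every `ε > 0` some NB approximant with coefficient mass
`Σ_j |c_j| ≤ B` has `‖χ − Σ c_j ρ_{a_j}‖_{L²(0,∞)} < ε`. MASS(B) implies the Báez-Duarte criterion,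
hence RH; part 2 (`Splittings.NbCoefficientMassRefuted`) shows MASS(B) is FALSE for every `B`. This
part proves the quantitative law behind it.

## Results (namespace `…Splittings.NbCoefficientMass`)

* `norm_head_nbFun_le`, `norm_tail_nbFun_le`, `mellin_indicator_nbFun_split` — head/tail estimate of
  `⟨f𝟙_{(0,1]}, t^{ρ-1}⟩` at `Re ρ = 1/2`: head `≤ 2√θ (1 + Σ|c_j|)` (sup bound `|f| ≤ 1 + Σ|c_j|`,
  the tree's `BaezDuarteU.norm_nbFun_le`), tail `≤ √log(1/θ) · ‖f‖₂` (Cauchy–Schwarz; the tree has the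
  reflected twin `BaezDuarteU.norm_tail_le` for `f♯ = Uf`).
* `core_mass` — at a zero `ρ = 1/2 + iγ` of `ζ`, for every `θ ∈ (0,1]`:
  `(1 − d)/|ρ| ≤ 2√θ (1 + Σ|c_j|) + √log(1/θ) · d`, `d = ‖f‖_{L²(0,∞)}` (left side: the tree's
  `BaezDuarteU.norm_mellin_indicator_nbFun_ge`, i.e. `M[f𝟙_{(0,1]}](ρ) = 1/ρ − M[f𝟙_{(1,∞)}](ρ)`).
* `massLaw` — **the mass law**: `((1 − d)/(4|ρ|)) · exp((1 − d)²/(8|ρ|² d²)) ≤ 1 + Σ_j |c_j|`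
  (no hypothesis on `d`; `θ = exp(−(1−d)²/(4|ρ|²d²))`). Same functional shape «complexity ≥ exp(c/d²)»
  as the BDBLS/Burnol LENGTH law `d ≥ C/√log N` of the tree (`BaezDuarteU.lowerBound_real`), for
  coefficient MASS instead of dilation LENGTH. (The quantity `1 + Σ|c_k|` is the tree's sup bound
  `Literature.NumberTheory.LFunctions.coeffBound`, used there only for integrability.)

Honest numerics (not used in proofs): with ONE zero (Hardy's first, `|ρ₁| ≈ 14.1436`) the exponent
constant is `1/(8|ρ₁|²) ≈ 6.2·10⁻⁴`; along the natural minimisers (`2π d_N² log N → 0.29`, BDBLS) the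
law reads `1 + mass(c⁽ᴺ⁾) ≥ 0.0177 · N^{0.0135}`, which is VACUOUS below `N ≈ 10¹³⁰` and a power law
beyond: the content is the SHAPE `mass ≥ exp(c/d²)` (it refutes every bounded and every polynomial
budget, part 2), not a usable numerical bound.
-/

noncomputable section

set_option linter.dupNamespace false

open Complex MeasureTheory Set Filter
open scoped Real

namespace Summit.RiemannHypothesis.RiemannHypothesis.Theorems.Splittings.NbCoefficientMass

open Literature.NumberTheory.LFunctions Literature.NumberTheory.LFunctions.BaezDuarteU

variable {n : ℕ} (a c : Fin n → ℝ)

/-! ## 1. Head, tail, split for `f = nbFun a c` -/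

/-- **Head**: for `Re ρ = 1/2` and `θ > 0`, `‖∫_{(0,θ]} t^{ρ-1} f‖ ≤ 2√θ (1 + Σ_j |c_j|)`
(pointwise `|f| ≤ 1 + Σ|c_j|`, `∫_0^θ t^{-1/2} dt = 2√θ`). -/
theorem norm_head_nbFun_le {ρ : ℂ} (hρ : ρ.re = 1 / 2) {θ : ℝ} (hθ0 : 0 < θ) :
    ‖∫ t in Ioc (0 : ℝ) θ, (t : ℂ) ^ (ρ - 1) * nbFun a c t‖ ≤
      2 * Real.sqrt θ * (1 + ∑ j, |c j|) := by
  set S : ℝ := ∑ j, |c j| with hS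
  have hS0 : 0 ≤ S := Finset.sum_nonneg fun j _ ↦ abs_nonneg _
  have hpt : ∀ t ∈ Ioc (0 : ℝ) θ, ‖(t : ℂ) ^ (ρ - 1) * nbFun a c t‖ ≤ (1 + S) * t ^ (-(1 / 2) : ℝ) := by
    intro t ht
    rw [norm_mul, norm_cpow_eq_rpow_re_of_pos ht.1, sub_re, hρ, one_re,
      show (1 / 2 - 1 : ℝ) = -(1 / 2) by norm_num, mul_comm]
    exact mul_le_mul_of_nonneg_right (norm_nbFun_le a c t) (Real.rpow_nonneg ht.1.le _)
  have hint : IntegrableOn (fun t : ℝ ↦ (1 + S) * t ^ (-(1 / 2) : ℝ)) (Ioc 0 θ) :=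
    ((intervalIntegral.intervalIntegrable_rpow' (a := 0) (b := θ) (by norm_num)).1).const_mul _
  have hval : ∫ t in Ioc (0 : ℝ) θ, (1 + S) * t ^ (-(1 / 2) : ℝ) = (1 + S) * (2 * Real.sqrt θ) := by
    rw [integral_const_mul, ← intervalIntegral.integral_of_le hθ0.le, integral_rpow (Or.inl (by norm_num))]
    congr 1
    rw [Real.zero_rpow (by norm_num), sub_zero, Real.sqrt_eq_rpow]
    ring_nf
  calc ‖∫ t in Ioc (0 : ℝ) θ, (t : ℂ) ^ (ρ - 1) * nbFun a c t‖
      ≤ ∫ t in Ioc (0 : ℝ) θ, ‖(t : ℂ) ^ (ρ - 1) * nbFun a c t‖ := norm_integral_le_integral_norm _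
    _ ≤ ∫ t in Ioc (0 : ℝ) θ, (1 + S) * t ^ (-(1 / 2) : ℝ) := by
        refine integral_mono_of_nonneg (Eventually.of_forall fun t ↦ norm_nonneg _) hint ?_
        exact (ae_restrict_iff' measurableSet_Ioc).2 (Eventually.of_forall hpt)
    _ = 2 * Real.sqrt θ * (1 + S) := by rw [hval]; ring

/-- **Tail** (Cauchy–Schwarz): for `Re ρ = 1/2`, `0 < θ ≤ 1`, `a_j ≥ 1`:
`‖∫_{(θ,1]} t^{ρ-1} f‖ ≤ √log(1/θ) · ‖f‖_{L²(0,∞)}` (the tree proves the same for `f♯ = Uf`,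
`BaezDuarteU.norm_tail_le`; this is the un-reflected copy). -/
theorem norm_tail_nbFun_le (ha : ∀ j, 1 ≤ a j) {ρ : ℂ} (hρ : ρ.re = 1 / 2) {θ : ℝ} (hθ0 : 0 < θ)
    (hθ1 : θ ≤ 1) :
    ‖∫ t in Ioc θ 1, (t : ℂ) ^ (ρ - 1) * nbFun a c t‖ ≤
      Real.sqrt (Real.log (1 / θ)) * Real.sqrt (∫ t in Ioi (0 : ℝ), ‖nbFun a c t‖ ^ 2) := by
  have hsub : Ioc θ 1 ⊆ Ioi 0 := fun t ht ↦ lt_trans hθ0 ht.1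
  have hf1 : ∀ t ∈ Ioc θ 1, ‖(t : ℂ) ^ (ρ - 1)‖ = t ^ (-(1 / 2) : ℝ) := by
    intro t ht
    rw [norm_cpow_eq_rpow_re_of_pos (lt_trans hθ0 ht.1), sub_re, hρ, one_re]
    norm_num
  have hInv : IntegrableOn (fun t : ℝ ↦ t⁻¹) (Ioc θ 1) := by
    have := (intervalIntegral.intervalIntegrable_inv (μ := volume) (a := θ) (b := 1) (f := id)
      (fun x hx ↦ by
        rw [uIcc_of_le hθ1] at hx; exact (ne_of_gt (lt_of_lt_of_le hθ0 hx.1)))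
      continuousOn_id).1
    simpa using this
  have hpow : EqOn (fun t : ℝ ↦ ‖(t : ℂ) ^ (ρ - 1)‖ ^ 2) (fun t : ℝ ↦ t⁻¹) (Ioc θ 1) := by
    intro t ht
    simp only
    rw [hf1 t ht, ← Real.rpow_natCast, ← Real.rpow_mul (lt_trans hθ0 ht.1).le,
      show (-(1 / 2 : ℝ)) * ((2 : ℕ) : ℝ) = -1 by norm_num, Real.rpow_neg_one]
  have hsq1 : IntegrableOn (fun t : ℝ ↦ ‖(t : ℂ) ^ (ρ - 1)‖ ^ 2) (Ioc θ 1) :=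
    hInv.congr_fun hpow.symm measurableSet_Ioc
  have hsq2 : IntegrableOn (fun t : ℝ ↦ ‖nbFun a c t‖ ^ 2) (Ioc θ 1) :=
    (integrableOn_norm_sq_nbFun a c ha).mono_set hsub
  have hm1 : AEStronglyMeasurable (fun t : ℝ ↦ ‖(t : ℂ) ^ (ρ - 1)‖) (volume.restrict (Ioc θ 1)) :=
    (Complex.measurable_ofReal.pow_const _).norm.aestronglyMeasurable
  have hm2 : AEStronglyMeasurable (fun t : ℝ ↦ ‖nbFun a c t‖) (volume.restrict (Ioc θ 1)) :=
    (measurable_nbFun a c).norm.aestronglyMeasurable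
  have hCS : ∫ t in Ioc θ 1, ‖(t : ℂ) ^ (ρ - 1)‖ * ‖nbFun a c t‖ ≤
      (∫ t in Ioc θ 1, ‖(t : ℂ) ^ (ρ - 1)‖ ^ 2) ^ (1 / 2 : ℝ) *
        (∫ t in Ioc θ 1, ‖nbFun a c t‖ ^ 2) ^ (1 / 2 : ℝ) := by
    have h := integral_mul_le_Lp_mul_Lq_of_nonneg (μ := volume.restrict (Ioc θ 1))
      Real.HolderConjugate.two_two
      (f := fun t : ℝ ↦ ‖(t : ℂ) ^ (ρ - 1)‖) (g := fun t : ℝ ↦ ‖nbFun a c t‖)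
      (Eventually.of_forall fun t ↦ norm_nonneg _) (Eventually.of_forall fun t ↦ norm_nonneg _)
      (by
        rw [ENNReal.ofReal_ofNat]
        refine (memLp_two_iff_integrable_sq_norm hm1).2 ?_
        simp only [norm_norm]
        exact hsq1)
      (by
        rw [ENNReal.ofReal_ofNat]
        refine (memLp_two_iff_integrable_sq_norm hm2).2 ?_
        simp only [norm_norm]
        exact hsq2)
    simpa only [Real.rpow_two] using h
  have hA : ∫ t in Ioc θ 1, ‖(t : ℂ) ^ (ρ - 1)‖ ^ 2 = Real.log (1 / θ) := by
    rw [setIntegral_congr_fun measurableSet_Ioc hpow, ← intervalIntegral.integral_of_le hθ1,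
      integral_inv_of_pos hθ0 zero_lt_one]
  have hB : ∫ t in Ioc θ 1, ‖nbFun a c t‖ ^ 2 ≤ ∫ t in Ioi (0 : ℝ), ‖nbFun a c t‖ ^ 2 :=
    setIntegral_mono_set (integrableOn_norm_sq_nbFun a c ha)
      (Eventually.of_forall fun t ↦ by positivity) (Eventually.of_forall hsub)
  calc ‖∫ t in Ioc θ 1, (t : ℂ) ^ (ρ - 1) * nbFun a c t‖
      ≤ ∫ t in Ioc θ 1, ‖(t : ℂ) ^ (ρ - 1) * nbFun a c t‖ := norm_integral_le_integral_norm _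
    _ = ∫ t in Ioc θ 1, ‖(t : ℂ) ^ (ρ - 1)‖ * ‖nbFun a c t‖ := by simp_rw [norm_mul]
    _ ≤ (∫ t in Ioc θ 1, ‖(t : ℂ) ^ (ρ - 1)‖ ^ 2) ^ (1 / 2 : ℝ) *
        (∫ t in Ioc θ 1, ‖nbFun a c t‖ ^ 2) ^ (1 / 2 : ℝ) := hCS
    _ ≤ Real.sqrt (Real.log (1 / θ)) * Real.sqrt (∫ t in Ioi (0 : ℝ), ‖nbFun a c t‖ ^ 2) := by
        rw [← Real.sqrt_eq_rpow, ← Real.sqrt_eq_rpow, hA]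
        exact mul_le_mul_of_nonneg_left (Real.sqrt_le_sqrt hB) (Real.sqrt_nonneg _)

/-- **Split** of the truncated Mellin integral of `f` at `θ ∈ (0,1]` (`Re ρ > 0`):
`M[f𝟙_{(0,1]}](ρ) = ∫_{(0,θ]} t^{ρ-1} f + ∫_{(θ,1]} t^{ρ-1} f`. -/
theorem mellin_indicator_nbFun_split {ρ : ℂ} (hρ0 : 0 < ρ.re) {θ : ℝ} (hθ0 : 0 < θ) (hθ1 : θ ≤ 1) :
    mellin ((Ioc (0 : ℝ) 1).indicator (nbFun a c)) ρ =
      (∫ t in Ioc (0 : ℝ) θ, (t : ℂ) ^ (ρ - 1) * nbFun a c t) +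
        ∫ t in Ioc θ 1, (t : ℂ) ^ (ρ - 1) * nbFun a c t := by
  have hconv := mellinConvergent_indicator (measurable_nbFun a c)
    (fun t _ ↦ norm_nbFun_le a c t) hρ0
  have hI : IntegrableOn (fun t : ℝ ↦ (t : ℂ) ^ (ρ - 1) * nbFun a c t) (Ioc 0 1) := by
    have h1 : IntegrableOn (fun t : ℝ ↦ (t : ℂ) ^ (ρ - 1) • (Ioc (0 : ℝ) 1).indicator (nbFun a c) t)
        (Ioc 0 1) := hconv.mono_set Ioc_subset_Ioi_self
    refine h1.congr_fun (fun t ht ↦ ?_) measurableSet_Ioc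
    simp only [indicator_of_mem ht, smul_eq_mul]
  rw [mellin_indicator_eq_setIntegral, ← Ioc_union_Ioc_eq_Ioc hθ0.le hθ1,
    setIntegral_union (Ioc_disjoint_Ioc_of_le le_rfl) measurableSet_Ioc
      (hI.mono_set (Ioc_subset_Ioc le_rfl hθ1)) (hI.mono_set (Ioc_subset_Ioc hθ0.le le_rfl))]

/-! ## 2. The core inequality at a critical-line zero and the mass law -/

/-- **Core**: if `ζ(1/2 + iγ) = 0` and `a_j ≥ 1` then for every `θ ∈ (0,1]`
`(1 − d)/|ρ| ≤ 2√θ (1 + Σ|c_j|) + √log(1/θ) · d`, `d = ‖f‖_{L²(0,∞)}`, `ρ = 1/2 + iγ`. -/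
theorem core_mass (ha : ∀ j, 1 ≤ a j) {γ : ℝ} (hγ : riemannZeta (1 / 2 + γ * I) = 0) {θ : ℝ}
    (hθ0 : 0 < θ) (hθ1 : θ ≤ 1) :
    (1 - Real.sqrt (∫ t in Ioi (0 : ℝ), ‖nbFun a c t‖ ^ 2)) / ‖(1 / 2 + γ * I : ℂ)‖ ≤
      2 * Real.sqrt θ * (1 + ∑ j, |c j|) +
        Real.sqrt (Real.log (1 / θ)) * Real.sqrt (∫ t in Ioi (0 : ℝ), ‖nbFun a c t‖ ^ 2) := by
  have hρre : (1 / 2 + γ * I : ℂ).re = 1 / 2 := by simp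
  have hρ0 : 0 < (1 / 2 + γ * I : ℂ).re := by rw [hρre]; norm_num
  have hlow := norm_mellin_indicator_nbFun_ge a c ha hγ
  rw [mellin_indicator_nbFun_split a c hρ0 hθ0 hθ1] at hlow
  exact hlow.trans ((norm_add_le _ _).trans
    (add_le_add (norm_head_nbFun_le a c hρre hθ0) (norm_tail_nbFun_le a c ha hρre hθ0 hθ1)))

/-- The `L²(0,∞)` distance `d = ‖χ − Σ_j c_j ρ_{a_j}‖₂` of the NB approximant with real dilations
`a_j` and real coefficients `c_j` (square root of the tree's `∫_{(0,∞)} ‖nbFun a c‖²`). -/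
def nbDist (a c : Fin n → ℝ) : ℝ := Real.sqrt (∫ t in Ioi (0 : ℝ), ‖nbFun a c t‖ ^ 2)

/-- The coefficient mass `Σ_j |c_j|` of the NB approximant `Σ_j c_j ρ_{a_j}`. -/
def coeffMass (c : Fin n → ℝ) : ℝ := ∑ j, |c j|

/-- The coefficient mass is nonnegative. -/
theorem coeffMass_nonneg : 0 ≤ coeffMass c := Finset.sum_nonneg fun _ _ ↦ abs_nonneg _

/-- The distance is nonnegative. -/
theorem nbDist_nonneg : 0 ≤ nbDist a c := Real.sqrt_nonneg _

/-- **The mass law.** If `ζ(ρ) = 0` with `ρ = 1/2 + iγ` and `a_j ≥ 1`, then with `d = ‖χ − Σ c_j ρ_{a_j}‖₂`: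
`((1 − d)/(4|ρ|)) · exp((1 − d)²/(8 |ρ|² d²)) ≤ 1 + Σ_j |c_j|` — no hypothesis on `d`
(for `d ≥ 1` the left side is `≤ 0`; for `d = 0` Lean's `x/0 = 0` makes it `1/(4|ρ|)`, still true).
Equivalently: an approximant of coefficient mass `S` cannot be closer to `χ` than
`≍ 1/(|ρ|√log S)`. -/
theorem massLaw (ha : ∀ j, 1 ≤ a j) {γ : ℝ} (hγ : riemannZeta (1 / 2 + γ * I) = 0) :
    (1 - nbDist a c) / (4 * ‖(1 / 2 + γ * I : ℂ)‖) *
        Real.exp ((1 - nbDist a c) ^ 2 / (8 * ‖(1 / 2 + γ * I : ℂ)‖ ^ 2 * nbDist a c ^ 2)) ≤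
      1 + coeffMass c := by
  unfold nbDist coeffMass
  set d : ℝ := Real.sqrt (∫ t in Ioi (0 : ℝ), ‖nbFun a c t‖ ^ 2) with hd
  set r : ℝ := ‖(1 / 2 + γ * I : ℂ)‖ with hr
  set S : ℝ := ∑ j, |c j| with hS
  have hd0 : 0 ≤ d := Real.sqrt_nonneg _
  have hS0 : 0 ≤ S := Finset.sum_nonneg fun j _ ↦ abs_nonneg _
  have hrpos : 0 < r := by
    rw [hr, norm_pos_iff]
    intro h
    have := congrArg Complex.re h
    simp at this
  rcases le_or_gt 1 d with hd1 | hd1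
  · -- `d ≥ 1`: the left side is nonpositive
    have h1 : (1 - d) / (4 * r) ≤ 0 := div_nonpos_of_nonpos_of_nonneg (by linarith) (by positivity)
    have h2 : (1 - d) / (4 * r) * Real.exp ((1 - d) ^ 2 / (8 * r ^ 2 * d ^ 2)) ≤ 0 :=
      mul_nonpos_iff.2 (Or.inr ⟨h1, (Real.exp_pos _).le⟩)
    linarith
  rcases hd0.eq_or_lt with hd00 | hdpos
  · -- `d = 0`: `θ = 1` in the core inequality gives `1/|ρ| ≤ 2 (1 + S)`
    have hcore := core_mass a c ha hγ zero_lt_one le_rfl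
    rw [← hd, ← hr, ← hS, ← hd00] at hcore
    rw [← hd00]
    norm_num at hcore ⊢
    nlinarith
  -- main case `0 < d < 1`: choose `θ = exp(−L)`, `L = (1−d)²/(4 r² d²)`
  set L : ℝ := (1 - d) ^ 2 / (4 * r ^ 2 * d ^ 2) with hL
  have hL0 : 0 ≤ L := by positivity
  set θ : ℝ := Real.exp (-L) with hθ
  have hθ0 : 0 < θ := Real.exp_pos _
  have hθ1 : θ ≤ 1 := Real.exp_le_one_iff.2 (by linarith)
  have hlog : Real.log (1 / θ) = L := by
    rw [hθ, one_div, ← Real.exp_neg, neg_neg, Real.log_exp]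
  have hsqrtL : Real.sqrt L = (1 - d) / (2 * r * d) := by
    rw [hL, show (1 - d) ^ 2 / (4 * r ^ 2 * d ^ 2) = ((1 - d) / (2 * r * d)) ^ 2 by
      rw [div_pow]; ring]
    exact Real.sqrt_sq (div_nonneg (by linarith) (by positivity))
  have hsqrtθ : Real.sqrt θ = Real.exp (-(L / 2)) := by
    rw [hθ, show Real.exp (-L) = Real.exp (-(L / 2)) ^ 2 by
      rw [sq, ← Real.exp_add]; congr 1; ring]
    exact Real.sqrt_sq (Real.exp_pos _).le
  have hcore := core_mass a c ha hγ hθ0 hθ1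
  rw [← hd, ← hr, ← hS, hlog, hsqrtL, hsqrtθ] at hcore
  have hsimp : (1 - d) / (2 * r * d) * d = (1 - d) / (2 * r) := by
    field_simp
  rw [hsimp] at hcore
  have h1 : (1 - d) / (2 * r) ≤ 2 * Real.exp (-(L / 2)) * (1 + S) := by
    have : (1 - d) / r = (1 - d) / (2 * r) + (1 - d) / (2 * r) := by ring
    linarith
  have hE : (1 - d) ^ 2 / (8 * r ^ 2 * d ^ 2) = L / 2 := by
    rw [hL]; ring
  rw [hE]
  calc (1 - d) / (4 * r) * Real.exp (L / 2)
      = (1 - d) / (2 * r) * (Real.exp (L / 2) / 2) := by ring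
    _ ≤ 2 * Real.exp (-(L / 2)) * (1 + S) * (Real.exp (L / 2) / 2) :=
        mul_le_mul_of_nonneg_right h1 (by positivity)
    _ = Real.exp (-(L / 2)) * Real.exp (L / 2) * (1 + S) := by ring
    _ = 1 + S := by rw [← Real.exp_add, neg_add_cancel, Real.exp_zero, one_mul]

end Summit.RiemannHypothesis.RiemannHypothesis.Theorems.Splittings.NbCoefficientMass

end
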